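import Summits.Ventures.PercRepro.ProfileThreeFourLine

/-!
# PercRepro — SERIES SETS AND THE COUNT OF RANK-`(u−1)` SETS: THE COMBINATORIAL CORE OF (GM)_1
(p10, gen 7; `proofs/P10-AVFULL.md` §9)

A **series set** `Z` of a finite matroid `N` (`SeriesSet N Z`): every member is a non-coloop and erasing any two
distinct members drops the rank of the ground set (every pair is a cocircuit).  Lemma A: a member of `Z` is a
coloop of every set containing it and missing another member.  Lemma B: `ρ(J ∪ Z'') = ρ(J) + #Z''` for
`J ⊆ E ∖ Z` and `Z'' ⊊ Z`.  Lemma C: `ρ(E ∖ Z) + (#Z − 1) = ρ(E)`.  Lemma D (the count, an injection from the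
pairs `(Z'', J)`): `Σ_{i < u, i ≠ #Z} C(#Z, i) · C(ρ(E ∖ Z), u−1−i) ≤ #{A : ρ(A) = u − 1}`.  Lemma V is
Vandermonde split at `i = #Z`, Lemma E the arithmetic `u · C(R−s, u−1−s) ≤ (R−s) · C(R−1, u−2)`, and the
**assembly** `choose_add_mul_le_of_seriesSet`: for a nonempty series set of a matroid of rank `R' ≥ u + 1`,
`C(R'+1, u−1) + #Z · C(R', u−2) ≤ u · #{A : ρ(A) = u − 1}` (`u ≥ 2`); without a series set,
`C(R'+1, u−1) ≤ u · #{A : ρ(A) = u − 1}` (`choose_succ_le_mul_card_levelSet`).  These are the ingredients of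
`gapMonoQ_one_of_simple` (ProfileGapMonoOne): the co-rank-1 gap is deletion-monotone at every non-coloop of a
simple matroid of rank `≥ u + 2`.

* `descFactorial_add'`, `descFactorial_mul_choose_shift`, `mul_choose_shift_le`, **`lemmaE`**;
* `SeriesSet`, **`mem_coloops_of_seriesSet`** (A), **`rk_union_of_seriesSet`** (B), **`rk_sdiff_seriesSet_add`** (C);
* `exists_indep_subset_card_rk`, `seriesMap`, **`sum_choose_le_card_levelSet_of_seriesSet`** (D);
* `sum_choose_filter_add_eq` (V), **`choose_add_mul_le_of_seriesSet`**, `choose_rk_le_card_levelSet`,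
  `choose_succ_le_mul_card_levelSet`.
-/

namespace PercRepro.Cogirth

open Finset
/-! ### Arithmetic -/

/-- `n.descFactorial (a + b) = n.descFactorial a * (n − a).descFactorial b`. -/
theorem descFactorial_add' (n a b : ℕ) :
    n.descFactorial (a + b) = n.descFactorial a * (n - a).descFactorial b := by
  induction b with
  | zero => simp
  | succ b ih =>
    rw [← Nat.add_assoc, Nat.descFactorial_succ, ih, Nat.descFactorial_succ, Nat.sub_sub]
    ring

/-- The shift identity `(u−2).descFactorial (s−1) · C(R−1, u−2) = (R−1).descFactorial (s−1) · C(R−s, u−1−s)`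
for `1 ≤ s ≤ u − 1 ≤ R − 1`. -/
theorem descFactorial_mul_choose_shift {u R s : ℕ} (hs1 : 1 ≤ s) (hsu : s ≤ u - 1) :
    (u - 2).descFactorial (s - 1) * (R - 1).choose (u - 2) =
      (R - 1).descFactorial (s - 1) * (R - s).choose (u - 1 - s) := by
  -- multiply both sides by `(u − 1 − s)!` and use `k! * C(n, k) = n.descFactorial k`
  have hfac : 0 < (u - 1 - s).factorial := Nat.factorial_pos _
  apply Nat.eq_of_mul_eq_mul_left hfac
  have h1 : (u - 1 - s).factorial * ((u - 2).descFactorial (s - 1) * (R - 1).choose (u - 2)) =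
      (u - 2).factorial * (R - 1).choose (u - 2) := by
    rw [← Nat.mul_assoc]
    congr 1
    have := Nat.factorial_mul_descFactorial (n := u - 2) (k := s - 1) (by omega)
    rw [show u - 2 - (s - 1) = u - 1 - s by omega] at this
    exact this
  have h2 : (u - 1 - s).factorial * ((R - 1).descFactorial (s - 1) * (R - s).choose (u - 1 - s)) =
      (R - 1).descFactorial (s - 1) * (R - s).descFactorial (u - 1 - s) := by
    rw [Nat.descFactorial_eq_factorial_mul_choose (R - s) (u - 1 - s)]
    ring
  rw [h1, h2, ← Nat.descFactorial_eq_factorial_mul_choose]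
  have h3 := descFactorial_add' (R - 1) (s - 1) (u - 1 - s)
  rw [show s - 1 + (u - 1 - s) = u - 2 by omega, show R - 1 - (s - 1) = R - s by omega] at h3
  exact h3

/-- **The arithmetic core**: `u · C(R−s, u−1−s) ≤ (R−s) · C(R−1, u−2)` for `2 ≤ u`, `u + 2 ≤ R`, `1 ≤ s ≤ u−1`. -/
theorem mul_choose_shift_le {u R s : ℕ} (hu : 2 ≤ u) (hR : u + 2 ≤ R) (hs1 : 1 ≤ s) (hsu : s ≤ u - 1) :
    u * (R - s).choose (u - 1 - s) ≤ (R - s) * (R - 1).choose (u - 2) := by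
  have hP : 0 < (R - 1).descFactorial (s - 1) := by
    rw [Nat.pos_iff_ne_zero, Ne, Nat.descFactorial_eq_zero_iff_lt]
    omega
  apply Nat.le_of_mul_le_mul_left _ hP
  -- `P_R · u · C(R−s, u−1−s) = u · P_u · C(R−1, u−2)` by the shift identity
  have hshift := descFactorial_mul_choose_shift (R := R) hs1 hsu
  calc (R - 1).descFactorial (s - 1) * (u * (R - s).choose (u - 1 - s))
      = u * ((R - 1).descFactorial (s - 1) * (R - s).choose (u - 1 - s)) := by ring
    _ = u * ((u - 2).descFactorial (s - 1) * (R - 1).choose (u - 2)) := by rw [hshift]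
    _ = (u * (u - 2).descFactorial (s - 1)) * (R - 1).choose (u - 2) := by ring
    _ ≤ ((R - 1).descFactorial s) * (R - 1).choose (u - 2) := by
        apply Nat.mul_le_mul_right
        -- `u · (u−2).descFactorial (s−1) ≤ (R−1) · (R−2).descFactorial (s−1) = (R−1).descFactorial s`
        have h1 : (R - 1).descFactorial s = (R - 1) * (R - 2).descFactorial (s - 1) := by
          have := Nat.succ_descFactorial_succ (R - 2) (s - 1)
          rw [show R - 2 + 1 = R - 1 by omega, show s - 1 + 1 = s by omega] at this
          exact this
        rw [h1]
        apply Nat.mul_le_mul (by omega)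
        exact Nat.descFactorial_le _ (by omega)
    _ = (R - 1).descFactorial (s - 1) * ((R - s) * (R - 1).choose (u - 2)) := by
        have h2 : (R - 1).descFactorial s = (R - s) * (R - 1).descFactorial (s - 1) := by
          have := Nat.descFactorial_succ (R - 1) (s - 1)
          rw [show s - 1 + 1 = s by omega, show R - 1 - (s - 1) = R - s by omega] at this
          exact this
        rw [h2]
        ring

/-- **Lemma E**: `C(R,u−1) + s · C(R−1,u−2) + u · [s ≤ u−1] · C(R−s, u−1−s) ≤ u · C(R, u−1)` for `2 ≤ u`,
`u + 2 ≤ R`, `1 ≤ s ≤ R`. -/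
theorem lemmaE {u R s : ℕ} (hu : 2 ≤ u) (hR : u + 2 ≤ R) (hs1 : 1 ≤ s) (hsR : s ≤ R) :
    R.choose (u - 1) + s * (R - 1).choose (u - 2) +
      u * (if s ≤ u - 1 then (R - s).choose (u - 1 - s) else 0) ≤ u * R.choose (u - 1) := by
  -- `(u−1) · C(R, u−1) = R · C(R−1, u−2)`
  have hkey : R * (R - 1).choose (u - 2) = R.choose (u - 1) * (u - 1) := by
    have := Nat.add_one_mul_choose_eq (R - 1) (u - 2)
    rw [show R - 1 + 1 = R by omega, show u - 2 + 1 = u - 1 by omega] at this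
    exact this
  have hu' : u * R.choose (u - 1) = R.choose (u - 1) + R * (R - 1).choose (u - 2) := by
    rw [hkey]
    calc u * R.choose (u - 1) = (u - 1 + 1) * R.choose (u - 1) := by
          congr 1
          omega
      _ = R.choose (u - 1) + R.choose (u - 1) * (u - 1) := by ring
  rw [hu']
  split_ifs with hsu
  · have := mul_choose_shift_le hu hR hs1 hsu
    have hsplit : R * (R - 1).choose (u - 2) = s * (R - 1).choose (u - 2) + (R - s) * (R - 1).choose (u - 2) := by
      rw [← Nat.add_mul, Nat.add_sub_cancel' hsR]
    omega
  · have : s * (R - 1).choose (u - 2) ≤ R * (R - 1).choose (u - 2) := Nat.mul_le_mul_right _ hsR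
    omega

/-! ### Series sets -/

open scoped Matroid

open ThmH Skew Shadow Profile

variable {α : Type} [DecidableEq α] {N : Matroid α} [N.Finite]

/-- **A series set** `Z` of `N`: every member is a non-coloop of `N`, and erasing any two distinct members drops
the rank of the ground set (every pair is a cocircuit). -/
def SeriesSet (N : Matroid α) [N.Finite] (Z : Finset α) : Prop :=
  Z ⊆ gr N ∧ (∀ x ∈ Z, rk N ((gr N).erase x) = rk N (gr N)) ∧
    (∀ x ∈ Z, ∀ y ∈ Z, x ≠ y → rk N (((gr N).erase x).erase y) < rk N (gr N))

/-- **Lemma A**: a member `x` of a series set is a coloop of every set containing `x` and missing another member. -/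
theorem mem_coloops_of_seriesSet {Z : Finset α} (hZ : SeriesSet N Z) {x y : α} (hx : x ∈ Z) (hy : y ∈ Z)
    (hxy : x ≠ y) {A : Finset α} (hA : A ⊆ gr N) (hxA : x ∈ A) (hyA : y ∉ A) : x ∈ coloops N A := by
  rw [mem_coloops]
  refine ⟨hxA, fun hcl => ?_⟩
  have hsub : A.erase x ⊆ ((gr N).erase y).erase x := by
    intro w hw
    rw [mem_erase] at hw
    rw [mem_erase, mem_erase]
    refine ⟨hw.1, fun hwy => hyA (hwy ▸ hw.2), hA hw.2⟩
  have hcl' : x ∈ clF N (((gr N).erase y).erase x) := clF_mono_sub hsub hcl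
  have hxE : x ∈ gr N := hZ.1 hx
  have hXE : ((gr N).erase y).erase x ⊆ gr N := (erase_subset _ _).trans (erase_subset _ _)
  have h := (mem_clF_iff_rk_insert_eq hxE hXE).1 hcl'
  rw [insert_erase (mem_erase.2 ⟨hxy, hxE⟩)] at h
  have h1 := hZ.2.1 y hy
  have h2 := hZ.2.2 y hy x hx (Ne.symm hxy)
  omega

/-- **Lemma B**: for `J ⊆ E ∖ Z` and a proper subset `Z'' ⊊ Z` of a series set, `ρ(J ∪ Z'') = ρ(J) + #Z''`. -/
theorem rk_union_of_seriesSet {Z : Finset α} (hZ : SeriesSet N Z) {J : Finset α} (hJ : J ⊆ gr N \ Z)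
    {Z'' : Finset α} (hZ'' : Z'' ⊆ Z) (hne : Z'' ≠ Z) : rk N (J ∪ Z'') = rk N J + Z''.card := by
  obtain ⟨y, hyZ, hyZ''⟩ : ∃ y ∈ Z, y ∉ Z'' := by
    by_contra h
    apply hne
    apply Subset.antisymm hZ''
    intro y hy
    by_contra hy'
    exact h ⟨y, hy, hy'⟩
  have hJE : J ⊆ gr N := hJ.trans sdiff_subset
  have hU : J ∪ Z'' ⊆ gr N := union_subset hJE (hZ''.trans hZ.1)
  have hcol : Z'' ⊆ coloops N (J ∪ Z'') := by
    intro x hx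
    apply mem_coloops_of_seriesSet hZ (hZ'' hx) hyZ (fun h => hyZ'' (h ▸ hx)) hU (mem_union_right _ hx)
    rw [mem_union, not_or]
    exact ⟨fun h => (mem_sdiff.1 (hJ h)).2 hyZ, hyZ''⟩
  have h := rk_sdiff_add_card_of_subset_coloops hU hcol
  have hdisj : Disjoint J Z'' := by
    rw [disjoint_left]
    intro x hxJ hxZ
    exact (mem_sdiff.1 (hJ hxJ)).2 (hZ'' hxZ)
  rw [union_sdiff_cancel_right hdisj] at h
  omega

/-- **Lemma C**: for a nonempty series set `Z`, `ρ(E ∖ Z) + (#Z − 1) = ρ(E)`. -/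
theorem rk_sdiff_seriesSet_add {Z : Finset α} (hZ : SeriesSet N Z) (hne : Z.Nonempty) :
    rk N (gr N \ Z) + (Z.card - 1) = rk N (gr N) := by
  obtain ⟨x₁, hx₁⟩ := hne
  have hA : (gr N).erase x₁ ⊆ gr N := erase_subset _ _
  have hcol : Z.erase x₁ ⊆ coloops N ((gr N).erase x₁) := by
    intro y hy
    rw [mem_erase] at hy
    apply mem_coloops_of_seriesSet hZ hy.2 hx₁ hy.1 hA
    · exact mem_erase.2 ⟨hy.1, hZ.1 hy.2⟩
    · exact fun h => (mem_erase.1 h).1 rfl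
  have h := rk_sdiff_add_card_of_subset_coloops hA hcol
  have hset : (gr N).erase x₁ \ Z.erase x₁ = gr N \ Z := by
    ext w
    simp only [mem_sdiff, mem_erase, not_and]
    constructor
    · rintro ⟨⟨hwx, hwE⟩, hw⟩
      exact ⟨hwE, fun hwZ => hw hwx hwZ⟩
    · rintro ⟨hwE, hwZ⟩
      have hwx : w ≠ x₁ := fun h => hwZ (h ▸ hx₁)
      exact ⟨⟨hwx, hwE⟩, fun _ => hwZ⟩
  rw [hset, card_erase_of_mem hx₁, hZ.2.1 x₁ hx₁] at h
  exact h

omit [DecidableEq α] in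
/-- A set `X ⊆ E` has an independent subset of size `ρ(X)`. -/
theorem exists_indep_subset_card_rk {X : Finset α} (hX : X ⊆ gr N) :
    ∃ I : Finset α, I ⊆ X ∧ N.Indep (I : Set α) ∧ I.card = rk N X := by
  have hXE : (X : Set α) ⊆ N.E := by rw [← coe_gr]; exact_mod_cast hX
  obtain ⟨I, hI⟩ := N.exists_isBasis (X : Set α) hXE
  have hIfin : I.Finite := (finite_toSet X).subset hI.subset
  refine ⟨hIfin.toFinset, ?_, ?_, ?_⟩
  · intro x hx
    rw [Set.Finite.mem_toFinset] at hx
    exact_mod_cast hI.subset hx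
  · rw [Set.Finite.coe_toFinset]
    exact hI.indep
  · have h := hI.encard_eq_eRk
    rw [← hIfin.coe_toFinset, Set.encard_coe_eq_coe_finsetCard, ← coe_rk] at h
    exact_mod_cast h

/-- The map of the counting injection: `⟨i, (Z₂, J)⟩ ↦ J ∪ Z₂`. -/
def seriesMap (p : Σ _ : ℕ, Finset α × Finset α) : Finset α := p.2.2 ∪ p.2.1

/-- **Lemma D (the count)**: for a series set `Z` with `s := #Z`, `R₀ := ρ(E ∖ Z)` and `u ≥ 1`:
`Σ_{i < u, i ≠ s} C(s, i) · C(R₀, u − 1 − i) ≤ #{A : ρ(A) = u − 1}`. -/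
theorem sum_choose_le_card_levelSet_of_seriesSet {Z : Finset α} (hZ : SeriesSet N Z) (u : ℕ) :
    ∑ i ∈ (range u).filter (fun i => i ≠ Z.card), Z.card.choose i * (rk N (gr N \ Z)).choose (u - 1 - i) ≤
      (levelSet N (u - 1)).card := by
  obtain ⟨I₀, hI₀X, hI₀ind, hI₀card⟩ := exists_indep_subset_card_rk (N := N) (X := gr N \ Z) sdiff_subset
  -- the domain: `⟨i, (Z₂, J)⟩` with `Z₂ ⊆ Z`, `#Z₂ = i ≠ s`, `J ⊆ I₀`, `#J = u − 1 − i`, `i < u`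
  set D : Finset (Σ _ : ℕ, Finset α × Finset α) :=
    ((range u).filter (fun i => i ≠ Z.card)).sigma
      (fun i => Z.powersetCard i ×ˢ I₀.powersetCard (u - 1 - i)) with hD
  have hcard : D.card = ∑ i ∈ (range u).filter (fun i => i ≠ Z.card),
      Z.card.choose i * (rk N (gr N \ Z)).choose (u - 1 - i) := by
    rw [hD, card_sigma]
    apply sum_congr rfl
    intro i _
    rw [card_product, card_powersetCard, card_powersetCard, hI₀card]
  rw [← hcard]
  apply card_le_card_of_injOn seriesMap
  · -- maps into the level set
    intro p hp
    rw [mem_coe, hD, mem_sigma, mem_filter, mem_range, mem_product, mem_powersetCard, mem_powersetCard] at hp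
    obtain ⟨⟨hi, hine⟩, ⟨hZ2Z, hZ2c⟩, ⟨hJI, hJc⟩⟩ := hp
    rw [mem_coe, mem_levelSet]
    have hJX : p.2.2 ⊆ gr N \ Z := hJI.trans hI₀X
    have hZ2ne : p.2.1 ≠ Z := fun h => hine (by rw [← hZ2c, h])
    have hrk := rk_union_of_seriesSet hZ hJX hZ2Z hZ2ne
    have hJrk : rk N p.2.2 = p.2.2.card := rk_eq_card_of_indep (hI₀ind.subset (by exact_mod_cast hJI))
    refine ⟨union_subset (hJX.trans sdiff_subset) (hZ2Z.trans hZ.1), ?_⟩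
    rw [← coe_rk]
    unfold seriesMap
    rw [hrk, hJrk, hJc, hZ2c]
    congr 1
    omega
  · -- injective
    intro p hp q hq hpq
    rw [mem_coe, hD, mem_sigma, mem_filter, mem_range, mem_product, mem_powersetCard, mem_powersetCard] at hp hq
    obtain ⟨⟨_, _⟩, ⟨hpZ, hpc⟩, ⟨hpJ, _⟩⟩ := hp
    obtain ⟨⟨_, _⟩, ⟨hqZ, hqc⟩, ⟨hqJ, _⟩⟩ := hq
    unfold seriesMap at hpq
    have hdisjp : Disjoint p.2.2 Z := by
      rw [disjoint_left]
      intro x hx hxZ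
      exact (mem_sdiff.1 (hI₀X (hpJ hx))).2 hxZ
    have hdisjq : Disjoint q.2.2 Z := by
      rw [disjoint_left]
      intro x hx hxZ
      exact (mem_sdiff.1 (hI₀X (hqJ hx))).2 hxZ
    -- the `Z`-part and the `J`-part are recovered from the union
    have hZpart : p.2.1 = q.2.1 := by
      have h := congrArg (fun W => W ∩ Z) hpq
      simp only [union_inter_distrib_right, inter_eq_left.2 hpZ, inter_eq_left.2 hqZ,
        disjoint_iff_inter_eq_empty.1 hdisjp, disjoint_iff_inter_eq_empty.1 hdisjq, empty_union] at h
      exact h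
    have hJpart : p.2.2 = q.2.2 := by
      have h := congrArg (fun W => W \ Z) hpq
      simp only [union_sdiff_distrib, sdiff_eq_self_of_disjoint hdisjp, sdiff_eq_self_of_disjoint hdisjq,
        sdiff_eq_empty_iff_subset.2 hpZ, sdiff_eq_empty_iff_subset.2 hqZ, union_empty] at h
      exact h
    have hi : p.1 = q.1 := by rw [← hpc, ← hqc, hZpart]
    obtain ⟨i, Z2, J⟩ := p
    obtain ⟨i2, Z3, J2⟩ := q
    simp only at hi hZpart hJpart
    subst hi hZpart hJpart
    rfl

/-! ### Vandermonde and the assembly in `N` -/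

/-- **Lemma V** (Vandermonde, split at `i = s`): for `u ≥ 1`,
`Σ_{i < u, i ≠ s} C(s,i) · C(R₀, u−1−i) + [s ≤ u−1] · C(R₀, u−1−s) = C(s + R₀, u−1)`. -/
theorem sum_choose_filter_add_eq (s R₀ u : ℕ) (hu : 1 ≤ u) :
    ∑ i ∈ (range u).filter (fun i => i ≠ s), s.choose i * R₀.choose (u - 1 - i) +
      (if s ≤ u - 1 then R₀.choose (u - 1 - s) else 0) = (s + R₀).choose (u - 1) := by
  rw [Nat.add_choose_eq, Finset.Nat.sum_antidiagonal_eq_sum_range_succ (fun i j => s.choose i * R₀.choose j),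
    show (u - 1).succ = u by omega, filter_ne']
  split_ifs with hs
  · have hmem : s ∈ range u := mem_range.2 (by omega)
    rw [← sum_erase_add _ _ hmem, Nat.choose_self, Nat.one_mul]
  · have hnot : s ∉ range u := fun h => hs (by have := mem_range.1 h; omega)
    rw [erase_eq_of_notMem hnot, add_zero]

/-- **The assembly in `N`**: for a nonempty series set `Z` (`s := #Z`) of a matroid of rank `R' ≥ u + 1`, `u ≥ 2`:
`C(R'+1, u−1) + s · C(R', u−2) ≤ u · #{A : ρ(A) = u − 1}`. -/
theorem choose_add_mul_le_of_seriesSet {Z : Finset α} (hZ : SeriesSet N Z) (hne : Z.Nonempty) {u : ℕ}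
    (hu : 2 ≤ u) (hR : u + 1 ≤ rk N (gr N)) :
    (rk N (gr N) + 1).choose (u - 1) + Z.card * (rk N (gr N)).choose (u - 2) ≤
      u * (levelSet N (u - 1)).card := by
  have hs1 : 1 ≤ Z.card := card_pos.2 hne
  have hC := rk_sdiff_seriesSet_add hZ hne
  have hD := sum_choose_le_card_levelSet_of_seriesSet hZ u
  have hV := sum_choose_filter_add_eq Z.card (rk N (gr N \ Z)) u (by omega)
  have hsum : Z.card + rk N (gr N \ Z) = rk N (gr N) + 1 := by omega
  rw [hsum] at hV
  have hE := lemmaE (u := u) (R := rk N (gr N) + 1) (s := Z.card) hu (by omega) hs1 (by omega)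
  rw [show rk N (gr N) + 1 - Z.card = rk N (gr N \ Z) by omega,
    show rk N (gr N) + 1 - 1 = rk N (gr N) by omega] at hE
  have hmul : u * (∑ i ∈ (range u).filter (fun i => i ≠ Z.card),
      Z.card.choose i * (rk N (gr N \ Z)).choose (u - 1 - i)) ≤ u * (levelSet N (u - 1)).card :=
    Nat.mul_le_mul_left _ hD
  have hmul2 : u * (∑ i ∈ (range u).filter (fun i => i ≠ Z.card),
      Z.card.choose i * (rk N (gr N \ Z)).choose (u - 1 - i)) +
      u * (if Z.card ≤ u - 1 then (rk N (gr N \ Z)).choose (u - 1 - Z.card) else 0) =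
      u * (rk N (gr N) + 1).choose (u - 1) := by
    rw [← Nat.mul_add, hV]
  omega

omit [DecidableEq α] in
/-- The `(u−1)`-subsets of a basis are rank-`(u−1)` sets: `C(ρ(E), u−1) ≤ #{A : ρ(A) = u − 1}`. -/
theorem choose_rk_le_card_levelSet (N : Matroid α) [N.Finite] (u : ℕ) :
    (rk N (gr N)).choose (u - 1) ≤ (levelSet N (u - 1)).card := by
  obtain ⟨I₀, hI₀X, hI₀ind, hI₀card⟩ := exists_indep_subset_card_rk (N := N) (X := gr N) (Subset.refl _)
  rw [← hI₀card, ← card_powersetCard]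
  apply card_le_card
  intro J hJ
  rw [mem_powersetCard] at hJ
  rw [mem_levelSet]
  refine ⟨hJ.1.trans hI₀X, ?_⟩
  rw [← coe_rk, rk_eq_card_of_indep (hI₀ind.subset (by exact_mod_cast hJ.1)), hJ.2]

omit [DecidableEq α] in
/-- **The assembly in `N` without series partners**: `C(R'+1, u−1) ≤ u · #{A : ρ(A) = u−1}` for `u ≥ 2`, `R' ≥ u`. -/
theorem choose_succ_le_mul_card_levelSet (N : Matroid α) [N.Finite] {u : ℕ} (hu : 2 ≤ u)
    (hR : u ≤ rk N (gr N)) :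
    (rk N (gr N) + 1).choose (u - 1) ≤ u * (levelSet N (u - 1)).card := by
  have h1 := choose_rk_le_card_levelSet N u
  -- `C(R'+1, u−1) = C(R', u−1) + C(R', u−2) ≤ u · C(R', u−1)` since `(u−1) · C(R', u−1) = (R'−u+2) · C(R', u−2) ≥ C(R', u−2)`
  have h2 : (rk N (gr N)).choose (u - 2 + 1) * (u - 2 + 1) = (rk N (gr N)).choose (u - 2) * (rk N (gr N) - (u - 2)) :=
    Nat.choose_succ_right_eq _ _
  rw [show u - 2 + 1 = u - 1 by omega] at h2
  have h3 : (rk N (gr N) + 1).choose (u - 1) = (rk N (gr N)).choose (u - 1) + (rk N (gr N)).choose (u - 2) := by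
    have := Nat.choose_succ_succ' (rk N (gr N)) (u - 2)
    rw [show u - 2 + 1 = u - 1 by omega] at this
    rw [this, Nat.add_comm]
  have h4 : (rk N (gr N)).choose (u - 2) ≤ (rk N (gr N)).choose (u - 2) * (rk N (gr N) - (u - 2)) :=
    Nat.le_mul_of_pos_right _ (by omega)
  have h5 : u * (levelSet N (u - 1)).card ≥ u * (rk N (gr N)).choose (u - 1) := Nat.mul_le_mul_left _ h1
  have h6 : u * (rk N (gr N)).choose (u - 1) = (rk N (gr N)).choose (u - 1) + (rk N (gr N)).choose (u - 1) * (u - 1) := by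
    have : u = 1 + (u - 1) := by omega
    calc u * (rk N (gr N)).choose (u - 1) = (1 + (u - 1)) * (rk N (gr N)).choose (u - 1) := by rw [← this]
      _ = (rk N (gr N)).choose (u - 1) + (rk N (gr N)).choose (u - 1) * (u - 1) := by ring
  omega


end PercRepro.Cogirth
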